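import Summits.RiemannHypothesis.RiemannHypothesis.Theses.RobinHighStaircase
import Summits.RiemannHypothesis.RiemannHypothesis.Theorems.Splittings.RobinFiniteHighCoverRanges
import HarnessLib

/-!
# Route RobinHighStaircase (L21 «ROBIN · HIGH STAIRCASE», line (ix-o)) — `RowsH26to30` (item stmt-RiemannHypothesis-22030)

Rows H26–H30: θ-prints + `RH(T)`, `T ≥ 6.82e8 / 1.40e9 / 2.88e9 / 5.91e9 / 1.22e10` ⟹ Robin at every CA `N > 5040`
with all primes `< 4^27 / 4^28 / 4^29 / 4^30 / 4^31`.
By-name closer over the lane (ix-o) «HIGH COVERS» theorems `RobinFiniteC1.robinCA_below_high_<T>`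
(`Theorems/Splittings/RobinFiniteHighCoverRanges.lean`, seat rh-split-robin-finite g18, refereed rh-split-ref-2 g5),
typed by the route decl (route file rev 2, sha16 4a58ad7cc9e42e43). RH-FREE in the rung sense (D-0061): the two
θ-prints (Büthe 2018 Thm 2, BKLNW 2021 §1.2) and a FINITE verified height `RiemannHypothesisUpTo T` stay in
hypothesis position; Robin's criterion is not invoked and RH is not proved by this; nothing here bears on the
truth of RH.
-/

-- D-0017: `Summit.RiemannHypothesis.RiemannHypothesis.…` duplicates the namespace BY DESIGN (single-problem summit).
set_option linter.dupNamespace false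

namespace Summit.RiemannHypothesis.RiemannHypothesis.Theorems.RobinHighStaircase

open Summit.RiemannHypothesis.RiemannHypothesis.Theorems.Splittings.RobinFiniteC1 in
/-- **`RowsH26to30` (item stmt-RiemannHypothesis-22030) holds**: conjuncts = `robinCA_below_high_682000000`,
`_1400000000`, `_2880000000`, `_5910000000`, `_12200000000`. -/
theorem rowsH26to30_proof :
    Summit.RiemannHypothesis.RiemannHypothesis.Theses.RobinHighStaircase.RowsH26to30 :=
  fun hB hK ↦ ⟨fun _ hT hRH ↦ robinCA_below_high_682000000 hB hK hT hRH,
    fun _ hT hRH ↦ robinCA_below_high_1400000000 hB hK hT hRH,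
    fun _ hT hRH ↦ robinCA_below_high_2880000000 hB hK hT hRH,
    fun _ hT hRH ↦ robinCA_below_high_5910000000 hB hK hT hRH,
    fun _ hT hRH ↦ robinCA_below_high_12200000000 hB hK hT hRH⟩

end Summit.RiemannHypothesis.RiemannHypothesis.Theorems.RobinHighStaircase
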